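import Literature.Computability.Cryptography.LWEAmplifyQuery
import HarnessLib

/-!
# The average-case-to-worst-case bridge for search-LWE, III: the majority post-processor

Topic `Computability/Cryptography` (LWE), grouping namespace `LWE.AmpBricks`, continuing
`LWEAmplifyQuery.lean`. The amplified solver runs `K₀(n)` attempts as the first `K₀(n)` of the
indexed parallel copies of `QuantumComplexity/PolyCopiesIdx.lean` (on the input `u = ⟨x, ε⟩`,
`x = encodeLWESamples S`; copy `j` occupies the wires `blk j 0 = base + j·b, …` of the measured
register, `b = nIn + pF(nIn) + 2`, `base = b + 1`, `nIn = |u| + (|u| + 1) = 4|x| + 5`, `pF` the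
ancilla-bound polynomial of the attempt family), each of which writes the CANONICAL code
`κⱼ = encodeSecret (candidateⱼ)` at the front of its segment (`LWEAmplifyAnswer.answerG_apply`).
This file is the classical post-processor of the whole family — the MAJORITY VOTE over the
candidates (Arora–Barak 2009, §7.4.1, proof of Thm 7.10) — as ONE total string function
`majorityG pF` on `⟨x, Y⟩` (`Y` the measured output string of the copies family), in the tree's
algebra of `FP` string functions:

* the layout numerals `bBC = bin b`, `bBaseC = bin base` and, for the piece context `⟨⟨x, Y⟩, 1ʲ⟩`,
  the offset `bin (base + j b)`, the candidate `candP = ⟨fstF (Y ⇂ offset), ε⟩` and the `appF`-fold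
  `candsC = ⟪κ₀, …, κ_{K₀−1}⟫` (a coded list);
* the counting fold `cntF ⟨κ, ⟪L⟫⟩ = bin #{a ∈ L | a = κ}` (`eqPairFn`, `StringEquality.lean`) and the
  selection fold `selF ⟨bin K₀, ⟪L⟫⟩` = the first item `a` of `L` with `K₀ < 2 · #{a' ∈ L | a' = a}`
  (`ε` if none), with their TOTAL semantics (`foldFn_apply`, `ListFoldBricks.lean`);
* **`majorityG pF ∈ FP`** and its values: `majorityG_apply` (the selection over the list of the
  `K₀` candidates `candOf pF x Y j = ⟨fstF (Y ⇂ (base + j b)), ε⟩`), and **`majorityG_eq_of_majority`**: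
  if more than half of the `K₀(n)` candidates equal `encodeSecret s`, the output IS `encodeSecret s`.

## References

* S. Arora, B. Barak, *Computational Complexity: A Modern Approach*, CUP 2009, §7.4.1 (error
  reduction by repetition and majority; proof of Thm 7.10), §1.3. [cite: AroraBarak2009, §7.4.1]
* O. Regev, *On lattices, learning with errors, random linear codes, and cryptography*, J. ACM 56
  (2009), art. 34, §2 (p. 12: success probability exponentially close to 1). [cite: Regev2009, §2 p. 12]
-/

noncomputable section

namespace Literature.Computability.Cryptography

namespace LWE

namespace AmpBricks

open _root_.Computability Polynomial Literature.Computability.Complexity Brick Plumb HashBricks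
open RegevBricks (loopRec loopRec_mem_FP loopRec_apply frames_ofFn_eq_ccat')

set_option synthInstance.maxSize 512

/-! ### The selection model -/

section Model

/-- The number of items of `L` equal to `a`. [folklore] -/
def cnt (L : List (List Bool)) (a : List Bool) : ℕ := (L.filter fun a' => a' = a).length

/-- `cnt` of the empty list. [folklore] -/
@[simp] theorem cnt_nil (a : List Bool) : cnt [] a = 0 := rfl

/-- `cnt` of a cons. [folklore] -/
theorem cnt_cons (b : List Bool) (l : List (List Bool)) (a : List Bool) :
    cnt (b :: l) a = cnt l a + if b = a then 1 else 0 := by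
  unfold cnt
  rw [List.filter_cons]
  by_cases h : b = a <;> simp [h]

/-- `cnt` of an `ofFn` list as a sum over the indices. [folklore] -/
theorem cnt_ofFn {k : ℕ} (f : Fin k → List Bool) (a : List Bool) : cnt (List.ofFn f) a = ∑ j, if f j = a then 1 else 0 := by
  induction k with
  | zero => simp
  | succ k ih => rw [List.ofFn_succ, cnt_cons, ih, Fin.sum_univ_succ, add_comm]

/-- Two distinct values have at most `|L|` occurrences together. [folklore] -/
theorem cnt_add_cnt_le {a a' : List Bool} (hne : a ≠ a') : ∀ L : List (List Bool), cnt L a + cnt L a' ≤ L.length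
  | [] => by simp
  | b :: l => by
    rw [cnt_cons, cnt_cons, List.length_cons]
    have ih := cnt_add_cnt_le hne l
    by_cases hb : b = a
    · have hb' : ¬ b = a' := fun h => hne (hb.symm.trans h)
      rw [if_pos hb, if_neg hb']; omega
    · rw [if_neg hb]; split_ifs <;> omega

/-- **The selection model**: fold over `L`, keeping the first item with a strict majority count.
[cite: AroraBarak2009, §7.4.1 (majority)] -/
def selFold (K : ℕ) (L : List (List Bool)) : List (List Bool) → List Bool → List Bool
  | [], acc => acc
  | a :: l, acc => selFold K L l (if acc = [] then (if K < 2 * cnt L a then a else []) else acc)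

/-- From a nonempty accumulator the selection does not move. [folklore] -/
theorem selFold_of_ne_nil (K : ℕ) (L : List (List Bool)) : ∀ (l : List (List Bool)) {acc : List Bool},
    acc ≠ [] → selFold K L l acc = acc
  | [], _, _ => rfl
  | a :: l, acc, h => by rw [selFold, if_neg h, selFold_of_ne_nil K L l h]

/-- Two distinct values cannot both have a strict majority. [folklore] -/
theorem eq_of_majority {L : List (List Bool)} {a a' : List Bool} (ha : L.length < 2 * cnt L a)
    (ha' : L.length < 2 * cnt L a') : a = a' := by
  by_contra hne
  have := cnt_add_cnt_le hne L
  omega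

/-- **The selection finds the majority value**: if `κ` has a strict majority in `L` and no item of the
scanned suffix is `ε`, the fold from `ε` returns `κ`. [cite: AroraBarak2009, §7.4.1 (majority)] -/
theorem selFold_eq_of_majority {L : List (List Bool)} {κ : List Bool} (hκ : L.length < 2 * cnt L κ) :
    ∀ (l : List (List Bool)), (∀ a ∈ l, a ≠ []) → κ ∈ l → selFold L.length L l [] = κ
  | [], _, h => absurd h List.not_mem_nil
  | a :: l, hne, hmem => by
    rw [selFold, if_pos rfl]
    by_cases hmaj : L.length < 2 * cnt L a
    · rw [if_pos hmaj, selFold_of_ne_nil _ _ _ (hne a List.mem_cons_self), eq_of_majority hmaj hκ]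
    · rw [if_neg hmaj]
      have hκa : κ ≠ a := fun h => hmaj (h ▸ hκ)
      exact selFold_eq_of_majority hκ l (fun a' ha' => hne a' (List.mem_cons_of_mem _ ha'))
        ((List.mem_cons.1 hmem).resolve_left hκa)

end Model

/-! ### The bricks -/

section Defs

variable (pF : Polynomial ℕ)

/-- The measured output `Y` of the copies family (second field of the context `⟨x, Y⟩`). [folklore] -/
def yC : List Bool → List Bool := sndF
/-- `1^{nIn}`, `nIn = 4|x| + 5` (the input length of a copy). [folklore] -/
def uNInC : List Bool → List Bool := polyFn (4 * X + 5) ∘ fstF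
/-- `1^{pF (nIn)}`. [folklore] -/
def uPFC : List Bool → List Bool := polyFn pF ∘ uNInC
/-- **`bin b`**, `b = nIn + pF(nIn) + 2` (the block width). [folklore] -/
def bBC : List Bool → List Bool := lenBinF ∘ fun ctx => uNInC ctx ++ uPFC pF ctx ++ [true, true]
/-- **`bin base`**, `base = b + 1`. [folklore] -/
def bBaseC : List Bool → List Bool := addFn ∘ fanoutFn (bBC pF) fun _ => encodeNat 1
/-- `bin (base + j b)`: the first wire of copy `j` (piece context `⟨ctx, 1ʲ⟩`). [folklore] -/
def bOffP : List Bool → List Bool :=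
  addFn ∘ fanoutFn (bBaseC pF ∘ fstF) (prodFn ∘ fanoutFn (lenBinF ∘ sndF) (bBC pF ∘ fstF))
/-- `1^{offset}` capped by `|Y|`. [folklore] -/
def uOffP : List Bool → List Bool := binToUnaryFn ∘ fanoutFn (yC ∘ fstF) (bOffP pF)
/-- `Y ⇂ offset`. [folklore] -/
def dropP : List Bool → List Bool := dropFn ∘ fanoutFn (uOffP pF) (yC ∘ fstF)
/-- **The candidate of copy `j`**: `⟨fstF (Y ⇂ offset), ε⟩` (the canonical code the attempt wrote at
the front of its segment, re-paired). [folklore] -/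
def candP : List Bool → List Bool := fanoutFn (fstF ∘ dropP pF) fun _ => []
/-- The one-item frame of the candidate (piece of the list fold). [folklore] -/
def candFrameP : List Bool → List Bool := fanoutFn (candP pF) fun _ => []
/-- **The coded list of the `K₀(n)` candidates**: an `appF`-fold over `j < K₀(n)`. [folklore] -/
def candsC : List Bool → List Bool := sndPow 2 ∘ foldLoop appF (clipF 6 (candFrameP pF)) X ∘ loopRec bK0Z

/-- The counting step `⟨⟨κ, ·⟩, ⟨a, acc⟩⟩ ↦ bin (⟦acc⟧ + [a = κ])`. [folklore] -/
def cntStep : List Bool → List Bool := addFn ∘ fanoutFn (sndF ∘ sndF) (eqPairFn ∘ fanoutFn (fstF ∘ sndF) (fstF ∘ fstF))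
/-- **`cntF ⟨κ, ⟪L⟫⟩ = bin #{a ∈ L | a = κ}`.** [folklore] -/
def cntF : List Bool → List Bool := foldFn cntStep fun _ => encodeNat 0
/-- The majority test of item `a` in the selection step: `[K₀ < 2 · cnt a]`. [folklore] -/
def majV : List Bool → List Bool :=
  ltFn ∘ fanoutFn (fstF ∘ fstF) (prodFn ∘ fanoutFn (fun _ => encodeNat 2) (cntF ∘ fanoutFn (fstF ∘ sndF) (sndF ∘ fstF)))
/-- **The selection step** `⟨⟨bin K₀, ⟪L⟫⟩, ⟨a, acc⟩⟩ ↦ acc` if `acc ≠ ε`, else `a` if it has a strict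
majority, else `ε`. [cite: AroraBarak2009, §7.4.1 (majority)] -/
def selStep : List Bool → List Bool := iteFn (isNilFn ∘ sndF ∘ sndF) (iteFn majV (fstF ∘ sndF) fun _ => []) (sndF ∘ sndF)
/-- **`selF ⟨bin K₀, ⟪L⟫⟩`**: the first item of `L` with a strict majority count (`ε` if none). [folklore] -/
def selF : List Bool → List Bool := foldFn selStep fun _ => []
/-- **The majority post-processor** on `⟨x, Y⟩`. [cite: AroraBarak2009, §7.4.1 (majority)] -/
def majorityG : List Bool → List Bool := selF ∘ fanoutFn bK0Z (candsC pF)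

end Defs

/-! ### Polynomial time -/

section FP

variable (pF : Polynomial ℕ)

/-- `yC ∈ FP`. [folklore] -/
theorem yC_mem_FP : yC ∈ FP := sndF_mem_FP
/-- `uNInC ∈ FP`. [folklore] -/
theorem uNInC_mem_FP : uNInC ∈ FP := comp_mem_FP (polyFn_mem_FP _) fstF_mem_FP
/-- `uPFC ∈ FP`. [folklore] -/
theorem uPFC_mem_FP : uPFC pF ∈ FP := comp_mem_FP (polyFn_mem_FP _) uNInC_mem_FP
/-- `bBC ∈ FP`. [folklore] -/
theorem bBC_mem_FP : bBC pF ∈ FP :=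
  comp_mem_FP lenBinF_mem_FP (append_mem_FP (append_mem_FP uNInC_mem_FP (uPFC_mem_FP pF)) (const_mem_FP _))
/-- `bBaseC ∈ FP`. [folklore] -/
theorem bBaseC_mem_FP : bBaseC pF ∈ FP := comp_mem_FP addFn_mem_FP (fanoutFn_mem_FP (bBC_mem_FP pF) (const_mem_FP _))
/-- `bOffP ∈ FP`. [folklore] -/
theorem bOffP_mem_FP : bOffP pF ∈ FP :=
  comp_mem_FP addFn_mem_FP (fanoutFn_mem_FP (comp_mem_FP (bBaseC_mem_FP pF) fstF_mem_FP)
    (comp_mem_FP prodFn_mem_FP (fanoutFn_mem_FP (comp_mem_FP lenBinF_mem_FP sndF_mem_FP) (comp_mem_FP (bBC_mem_FP pF) fstF_mem_FP))))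
/-- `uOffP ∈ FP`. [folklore] -/
theorem uOffP_mem_FP : uOffP pF ∈ FP :=
  comp_mem_FP binToUnaryFn_mem_FP (fanoutFn_mem_FP (comp_mem_FP yC_mem_FP fstF_mem_FP) (bOffP_mem_FP pF))
/-- `dropP ∈ FP`. [folklore] -/
theorem dropP_mem_FP : dropP pF ∈ FP :=
  comp_mem_FP dropFn_mem_FP (fanoutFn_mem_FP (uOffP_mem_FP pF) (comp_mem_FP yC_mem_FP fstF_mem_FP))
/-- `candP ∈ FP`. [folklore] -/
theorem candP_mem_FP : candP pF ∈ FP := fanoutFn_mem_FP (comp_mem_FP fstF_mem_FP (dropP_mem_FP pF)) (const_mem_FP _)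
/-- `candFrameP ∈ FP`. [folklore] -/
theorem candFrameP_mem_FP : candFrameP pF ∈ FP := fanoutFn_mem_FP (candP_mem_FP pF) (const_mem_FP _)
/-- `candsC ∈ FP`. [folklore] -/
theorem candsC_mem_FP : candsC pF ∈ FP :=
  comp_mem_FP (sndPow_mem_FP 2) (comp_mem_FP (foldLoop_clipF_mem_FP 6 appF_mem_FP length_appF_le (candFrameP_mem_FP pF) X)
    (loopRec_mem_FP bK0Z_mem_FP))
/-- `cntStep ∈ FP`. [folklore] -/
theorem cntStep_mem_FP : cntStep ∈ FP :=
  comp_mem_FP addFn_mem_FP (fanoutFn_mem_FP (comp_mem_FP sndF_mem_FP sndF_mem_FP)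
    (comp_mem_FP eqPairFn_mem_FP (fanoutFn_mem_FP (comp_mem_FP fstF_mem_FP sndF_mem_FP) (comp_mem_FP fstF_mem_FP fstF_mem_FP))))
/-- `cntStep` on a step argument. [folklore] -/
theorem cntStep_apply (u a acc : List Bool) :
    cntStep (boolPair u (boolPair a acc)) = encodeNat (bitsToNat acc + bitsToNat (eqPairFn (boolPair a (fstF u)))) := by
  simp [cntStep]
/-- An equality bit is a numeral of length `1`. [folklore] -/
theorem length_eqPairFn (w : List Bool) : (eqPairFn w).length = 1 := by
  rcases eqPairFn_eq_or w with h | h <;> rw [h] <;> rfl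
/-- Growth of `cntStep`: `|bin (acc + bit)| ≤ |acc| + 2`. [folklore] -/
theorem foldGrowth_cntStep : FoldGrowth 2 cntStep := fun v => by
  have e : cntStep v = addFn (boolPair (sndF (sndF v)) (eqPairFn (boolPair (fstF (sndF v)) (fstF (fstF v))))) := by
    simp only [cntStep, Function.comp_apply, fanoutFn_apply]
  rw [e, addFn_boolPair]
  have h := length_encodeNat_add_le (sndF (sndF v)) (eqPairFn (boolPair (fstF (sndF v)) (fstF (fstF v))))
  rw [length_eqPairFn] at h
  omega
/-- `cntF ∈ FP`. [folklore] -/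
theorem cntF_mem_FP : cntF ∈ FP := foldFn_mem_FP cntStep_mem_FP (const_mem_FP _) foldGrowth_cntStep
/-- `majV ∈ FP`. [folklore] -/
theorem majV_mem_FP : majV ∈ FP :=
  comp_mem_FP ltFn_mem_FP (fanoutFn_mem_FP (comp_mem_FP fstF_mem_FP fstF_mem_FP)
    (comp_mem_FP prodFn_mem_FP (fanoutFn_mem_FP (const_mem_FP _)
      (comp_mem_FP cntF_mem_FP (fanoutFn_mem_FP (comp_mem_FP fstF_mem_FP sndF_mem_FP) (comp_mem_FP sndF_mem_FP fstF_mem_FP))))))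
/-- `majV` is one-bit. [folklore] -/
theorem oneBit_majV : OneBit majV := oneBit_ltFn.comp _
/-- `selStep ∈ FP`. [folklore] -/
theorem selStep_mem_FP : selStep ∈ FP :=
  iteFn_mem_FP (comp_mem_FP isNilFn_mem_FP (comp_mem_FP sndF_mem_FP sndF_mem_FP))
    (iteFn_mem_FP majV_mem_FP (comp_mem_FP fstF_mem_FP sndF_mem_FP) (const_mem_FP _)) (comp_mem_FP sndF_mem_FP sndF_mem_FP)
/-- **`selStep` spelled out** on every input: `acc`, or `a`/`ε` by the majority test. [folklore] -/
theorem selStep_eq (v : List Bool) :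
    selStep v = if sndF (sndF v) = [] then (if majV v = [true] then fstF (sndF v) else []) else sndF (sndF v) := by
  obtain ⟨bm, hbm⟩ := oneBit_majV v
  rw [selStep, iteFn_apply (show (isNilFn ∘ sndF ∘ sndF) v = [decide (sndF (sndF v) = [])] from rfl)]
  by_cases h : sndF (sndF v) = []
  · rw [decide_eq_true h, if_pos rfl, if_pos h, iteFn_apply hbm, hbm]
    cases bm <;> simp
  · rw [decide_eq_false h, if_neg h]
    simp
/-- Growth of `selStep`: none (the output is `acc`, `a` or `ε`). [folklore] -/
theorem foldGrowth_selStep : FoldGrowth 0 selStep := fun v => by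
  rw [selStep_eq]
  split_ifs <;> simp only [zero_mul, add_zero, List.length_nil] <;> omega
/-- `selF ∈ FP`. [folklore] -/
theorem selF_mem_FP : selF ∈ FP := foldFn_mem_FP selStep_mem_FP (const_mem_FP _) foldGrowth_selStep
/-- **`majorityG pF ∈ FP`.** [cite: AroraBarak2009, §1.3] -/
theorem majorityG_mem_FP : majorityG pF ∈ FP := comp_mem_FP selF_mem_FP (fanoutFn_mem_FP bK0Z_mem_FP (candsC_mem_FP pF))

end FP

/-! ### Values -/

section Values

variable (pF : Polynomial ℕ) {n q m : ℕ} (S : Fin (K0 n * m) → (Fin n → ZMod q) × ZMod q) (Y : List Bool)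

/-- The input length of a copy: `nIn = 4|x| + 5` (`x = encodeLWESamples S`). [folklore] -/
def nInPost : ℕ := 4 * (encodeLWESamples S).length + 5
/-- The block width `b = nIn + pF(nIn) + 2`. [folklore] -/
def bPost : ℕ := nInPost S + pF.eval (nInPost S) + 2
/-- The first block wire `base = b + 1`. [folklore] -/
def basePost : ℕ := bPost pF S + 1
/-- **The first wire of copy `j`**: `base + j b`. [folklore] -/
def offPost (j : ℕ) : ℕ := basePost pF S + j * bPost pF S
/-- **The candidate of copy `j`**: the first pair component of `Y` from the copy's first wire on,
re-paired with `ε`. [folklore] -/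
def candOf (j : ℕ) : List Bool := boolPair (fstF (Y.drop (offPost pF S j))) []
/-- The context `⟨x, Y⟩`. [folklore] -/
def ctxOf : List Bool := boolPair (encodeLWESamples S) Y

/-- `ctxOf` unfolded. [folklore] -/
theorem ctxOf_eq : ctxOf S Y = boolPair (encodeLWESamples S) Y := rfl

/-- Value of `bK0Z` on any pair with first component `encodeLWESamples S`. [folklore] -/
@[simp] theorem bK0Z_pair (w : List Bool) : bK0Z (boolPair (encodeLWESamples S) w) = encodeNat (K0 n) := by
  simp [bK0Z, bnZ, xZ, encodeLWESamples_eq, K0]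

/-- Value of `uNInC`. [folklore] -/
@[simp] theorem uNInC_ctx : uNInC (ctxOf S Y) = ones (nInPost S) := by
  simp [uNInC, ctxOf, nInPost]

/-- Value of `bBC`: `bin b`. [folklore] -/
@[simp] theorem bBC_ctx : bBC pF (ctxOf S Y) = encodeNat (bPost pF S) := by
  rw [bBC, Function.comp_apply, lenBinF_apply, uPFC, Function.comp_apply, uNInC_ctx, polyFn_apply]
  simp [ones, bPost]

/-- Value of `bBaseC`: `bin base`. [folklore] -/
@[simp] theorem bBaseC_ctx : bBaseC pF (ctxOf S Y) = encodeNat (basePost pF S) := by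
  simp [bBaseC, basePost]

variable (j : ℕ)

/-- The piece context of copy `j`. [folklore] -/
def pcOf : List Bool := boolPair (ctxOf S Y) (ones j)

/-- Value of `bOffP`: `bin (base + j b)`. [folklore] -/
@[simp] theorem bOffP_pc : bOffP pF (pcOf S Y j) = encodeNat (offPost pF S j) := by
  simp [bOffP, pcOf, ones, offPost]

/-- Value of `dropP`: `Y ⇂ offset` (offset within `Y`). [folklore] -/
theorem dropP_pc (h : offPost pF S j ≤ Y.length) : dropP pF (pcOf S Y j) = Y.drop (offPost pF S j) := by
  rw [dropP, Function.comp_apply, fanoutFn_apply, uOffP, Function.comp_apply, fanoutFn_apply, bOffP_pc]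
  simp only [yC, Function.comp_apply, pcOf, fstF_boolPair, ctxOf, sndF_boolPair, binToUnaryFn_boolPair, bitsToNat_encodeNat,
    min_eq_left h, dropFn_boolPair, ones, List.length_replicate]

/-- **Value of `candP`**: the candidate of copy `j`. [folklore] -/
theorem candP_pc (h : offPost pF S j ≤ Y.length) : candP pF (pcOf S Y j) = candOf pF S Y j := by
  rw [candP, fanoutFn_apply, Function.comp_apply, dropP_pc pF S Y j h, candOf]

/-- Value of `candFrameP` (raw index). [folklore] -/
theorem candFrameP_apply (h : offPost pF S j ≤ Y.length) :
    candFrameP pF (boolPair (ctxOf S Y) (ones j)) = boolPair (candOf pF S Y j) [] := by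
  rw [candFrameP, fanoutFn_apply, ← show pcOf S Y j = boolPair (ctxOf S Y) (ones j) from rfl, candP_pc pF S Y j h]

variable {j}

/-- A candidate is short: `|candOf| ≤ 2|Y| + 2`. [folklore] -/
theorem length_candOf_le (j : ℕ) : (candOf pF S Y j).length ≤ 2 * Y.length + 2 := by
  rw [candOf, length_boolPair, List.length_nil]
  have h1 := length_fstF_sndF_le (Y.drop (offPost pF S j))
  have h2 : (Y.drop (offPost pF S j)).length ≤ Y.length := by rw [List.length_drop]; omega
  omega

/-- **Value of `candsC`**: the coded list of the `K₀(n)` candidates (all copies within `Y`, `0 < m`).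
[folklore] -/
theorem candsC_ctx (hm : 0 < m) (hoff : ∀ j, j < K0 n → offPost pF S j ≤ Y.length) :
    candsC pF (ctxOf S Y) = encList (List.ofFn fun j : Fin (K0 n) => candOf pF S Y j) := by
  obtain ⟨-, -, hKm⟩ := le_length_encodeLWESamples (Nat.mul_pos (K0_pos n) hm) S
  have hK : K0 n ≤ (X : Polynomial ℕ).eval (ctxOf S Y).length := by
    have : K0 n ≤ K0 n * m := Nat.le_mul_of_pos_right _ hm
    rw [eval_X, ctxOf_eq, length_boolPair]; omega
  rw [candsC, Function.comp_apply, Function.comp_apply, loopRec_apply, ctxOf_eq, bK0Z_pair, ← ctxOf_eq, foldLoop_apply _ _ hK,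
    sndPow_succ_boolPair, sndPow_succ_boolPair, sndPow_zero, sndF_boolPair, foldAcc_clipF, foldAcc_appF, List.nil_append,
    ← frames_eq_encList, frames_ofFn_eq_ccat']
  · refine ccat_congr fun i hi => ?_
    rw [zero_add, candFrameP_apply pF S Y i (hoff i hi), dif_pos hi]
  · intro i _ hi
    rw [zero_add] at hi
    rw [candFrameP_apply pF S Y i (hoff i hi), length_boolPair, List.length_nil, ctxOf_eq, length_boolPair]
    have := length_candOf_le pF S Y i
    omega

/-- The left fold of the counting step from a numeral. [folklore] -/
theorem foldl_cntStep (u : List Bool) : ∀ (l : List (List Bool)) (k : ℕ),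
    l.foldl (fun acc a => cntStep (boolPair u (boolPair a acc))) (encodeNat k) = encodeNat (k + cnt l (fstF u))
  | [], k => by simp [cnt]
  | a :: l, k => by
    rw [List.foldl_cons, cntStep_apply, bitsToNat_encodeNat, eqPairFn_boolPair, foldl_cntStep u l]
    congr 1
    unfold cnt
    rw [List.filter_cons]
    by_cases h : a = fstF u
    · simp [h]; omega
    · simp [h]

/-- **Value of `cntF ⟨κ, ⟪L⟫⟩`**: the number of items equal to `κ`. [folklore] -/
theorem cntF_boolPair (κ : List Bool) (L : List (List Bool)) : cntF (boolPair κ (encList L)) = encodeNat (cnt L κ) := by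
  rw [cntF, foldFn_apply, sndF_boolPair, decNil_encList, show encodeNat 0 = encodeNat 0 from rfl, foldl_cntStep, fstF_boolPair,
    zero_add]

/-- **Value of `majV`** on a step argument of the selection fold. [folklore] -/
theorem majV_apply (K : ℕ) (L : List (List Bool)) (a acc : List Bool) :
    majV (boolPair (boolPair (encodeNat K) (encList L)) (boolPair a acc)) = [decide (K < 2 * cnt L a)] := by
  simp [majV, cntF_boolPair]

/-- The left fold of the selection step is the selection model. [folklore] -/
theorem foldl_selStep (K : ℕ) (L : List (List Bool)) : ∀ (l : List (List Bool)) (acc : List Bool),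
    l.foldl (fun acc a => selStep (boolPair (boolPair (encodeNat K) (encList L)) (boolPair a acc))) acc = selFold K L l acc
  | [], acc => rfl
  | a :: l, acc => by
    rw [List.foldl_cons, selFold, ← foldl_selStep K L l]
    congr 1
    rw [selStep_eq]
    simp only [sndF_boolPair, fstF_boolPair, majV_apply, List.cons.injEq, and_true, decide_eq_true_eq]

/-- **Value of `selF ⟨bin K, ⟪L⟫⟩`**: the selection model. [folklore] -/
theorem selF_boolPair (K : ℕ) (L : List (List Bool)) : selF (boolPair (encodeNat K) (encList L)) = selFold K L L [] := by
  rw [selF, foldFn_apply, sndF_boolPair, decNil_encList, foldl_selStep]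

/-- **Value of the majority post-processor**: the selection over the `K₀(n)` candidates. [cite: AroraBarak2009, §7.4.1 (majority)] -/
theorem majorityG_apply (hm : 0 < m) (hoff : ∀ j, j < K0 n → offPost pF S j ≤ Y.length) :
    majorityG pF (ctxOf S Y) =
      selFold (K0 n) (List.ofFn fun j : Fin (K0 n) => candOf pF S Y j) (List.ofFn fun j : Fin (K0 n) => candOf pF S Y j) [] := by
  rw [majorityG, Function.comp_apply, fanoutFn_apply, candsC_ctx pF S Y hm hoff, ctxOf_eq, bK0Z_pair, selF_boolPair]

/-- **Majority**: if more than half of the `K₀(n)` candidates are `encodeSecret s`, the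
post-processor outputs `encodeSecret s`. [cite: AroraBarak2009, §7.4.1 (proof of Thm 7.10: majority vote)] -/
theorem majorityG_eq_of_majority (hm : 0 < m) (hoff : ∀ j, j < K0 n → offPost pF S j ≤ Y.length) (s : Fin n → ZMod q)
    (hmaj : K0 n < 2 * (Finset.univ.filter fun j : Fin (K0 n) => candOf pF S Y j = encodeSecret s).card) :
    majorityG pF (ctxOf S Y) = encodeSecret s := by
  rw [majorityG_apply pF S Y hm hoff]
  set L := List.ofFn fun j : Fin (K0 n) => candOf pF S Y j with hL
  have hlen : L.length = K0 n := by rw [hL, List.length_ofFn]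
  have hcnt : (Finset.univ.filter fun j : Fin (K0 n) => candOf pF S Y j = encodeSecret s).card = cnt L (encodeSecret s) := by
    rw [hL, cnt_ofFn, Finset.card_filter]
  rw [hcnt] at hmaj
  rw [← hlen] at hmaj ⊢
  refine selFold_eq_of_majority hmaj L (fun a ha => ?_) ?_
  · rw [hL, List.mem_ofFn] at ha
    obtain ⟨j, rfl⟩ := ha
    rw [candOf]; intro h; simpa using congrArg List.length h
  · -- `encodeSecret s` occurs (its count is positive)
    have hpos : 0 < cnt L (encodeSecret s) := by omega
    unfold cnt at hpos
    obtain ⟨a, ha⟩ := List.length_pos_iff_exists_mem.1 hpos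
    rw [List.mem_filter] at ha
    simp only [decide_eq_true_eq] at ha
    rw [← ha.2]; exact ha.1

end Values

end AmpBricks

end LWE

end Literature.Computability.Cryptography
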